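import Literature.Topology.PlaneTopology.RectilinearLoops
import HarnessLib

/-!
# Rectilinear lattice loops: the three local moves

Topic `Literature/Topology/PlaneTopology`; second file of the rectilinear Umlaufsatz
(`RectilinearLoops.lean`, `RectilinearUmlaufsatz.lean`). At a **corner** `v` of a loop (its two
neighbours `v + a`, `v + b` in perpendicular directions) with opposite cell corner
`v' = v + a + b` we have three turning-preserving moves:

* **flip** (`v' ∉` loop): replace `v` by `v'` — same length;
* **forward shortcut** (`v'` is the vertex after `v + b`): replace `v + a, v, v + b, v'` by
  `v + a, v'` — two vertices fewer;
* **backward shortcut** (`v'` is the vertex before `v + a`): symmetric.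

In each case the new list is again a loop with the same signed number of quarter turns
(`flip_isLoop`/`cycTurn_flip`, `fwd_isLoop`/`cycTurn_fwd`, `bwd_isLoop`/`cycTurn_bwd`). The
turning bookkeeping is a finite identity over the direction indices (`flip_identity`,
`fwd_identity`, `bwd_identity`, by `decide`): the constraints forced by distinctness of the
vertices leave two values for the incoming and two for the outgoing direction, and in all cases
the local turning sums agree. Everything here is proved; folklore (the standard reduction of
orthogonal lattice polygons to the unit square). [folklore]
-/

namespace Literature.Topology.PlaneTopology

namespace RectLoop

open List

/-! ### The finite identities -/

set_option synthInstance.maxSize 1024 in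
/-- Flip: old steps `d, -a, b, e`, new steps `d, b, -a, e`; equal turning under the distinctness
constraints. [folklore] -/
theorem flip_identity : ∀ (ia ib ip iq : Fin 4), cross (dir ia) (dir ib) ≠ 0 →
    dir ip ≠ dir ia → dir ip ≠ -dir ib → dir iq ≠ -dir ib → dir iq ≠ dir ia →
    cross (dir ip) (-dir ia) + cross (-dir ia) (dir ib) + cross (dir ib) (dir iq) =
      cross (dir ip) (dir ib) + cross (dir ib) (-dir ia) + cross (-dir ia) (dir iq) := by
  decide

set_option synthInstance.maxSize 1024 in
/-- Forward shortcut: old steps `d, -a, b, a, e`, new steps `d, b, e`. [folklore] -/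
theorem fwd_identity : ∀ (ia ib ip iq : Fin 4), cross (dir ia) (dir ib) ≠ 0 →
    dir ip ≠ dir ia → dir ip ≠ -dir ib → dir iq ≠ -dir ia → dir iq ≠ -dir ib →
    cross (dir ip) (-dir ia) + cross (-dir ia) (dir ib) + cross (dir ib) (dir ia) + cross (dir ia) (dir iq) =
      cross (dir ip) (dir ib) + cross (dir ib) (dir iq) := by
  decide

set_option synthInstance.maxSize 1024 in
/-- Backward shortcut: old steps `d, -b, -a, b, e`, new steps `d, -a, e`. [folklore] -/
theorem bwd_identity : ∀ (ia ib ip iq : Fin 4), cross (dir ia) (dir ib) ≠ 0 →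
    dir ip ≠ dir ia → dir ip ≠ dir ib → dir iq ≠ -dir ib → dir iq ≠ dir ia →
    cross (dir ip) (-dir ib) + cross (-dir ib) (-dir ia) + cross (-dir ia) (dir ib) + cross (dir ib) (dir iq) =
      cross (dir ip) (-dir ia) + cross (-dir ia) (dir iq) := by
  decide

/-! ### Unpacking a loop window -/

/-- The adjacencies and the tail chain of a loop with five explicit vertices. [folklore] -/
theorem IsLoop.window {x₀ x₁ v x₃ x₄ : ℤ × ℤ} {R : List (ℤ × ℤ)}
    (h : IsLoop (x₀ :: x₁ :: v :: x₃ :: x₄ :: R)) :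
    Adj x₀ x₁ ∧ Adj x₁ v ∧ Adj v x₃ ∧ Adj x₃ x₄ ∧ IsChain Adj (x₄ :: (R ++ [x₀])) := by
  have hc := h.chain
  simp only [cons_append, take_succ_cons, take_zero, isChain_cons_cons] at hc
  exact ⟨hc.1, hc.2.1, hc.2.2.1, hc.2.2.2.1, hc.2.2.2.2⟩

/-- Assembling a loop from its adjacencies (three explicit vertices). [folklore] -/
theorem isLoop_of_window3 {x₀ x₁ x₂ : ℤ × ℤ} {R : List (ℤ × ℤ)} (hnd : (x₀ :: x₁ :: x₂ :: R).Nodup)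
    (h₀ : Adj x₀ x₁) (h₁ : Adj x₁ x₂) (hc : IsChain Adj (x₂ :: (R ++ [x₀]))) :
    IsLoop (x₀ :: x₁ :: x₂ :: R) := by
  refine ⟨by simp, hnd, ?_⟩
  simp only [cons_append, take_succ_cons, take_zero, isChain_cons_cons]
  exact ⟨h₀, h₁, hc⟩

/-! ### The flip -/

section Flip

variable {x₀ x₁ v x₃ x₄ : ℤ × ℤ} {R : List (ℤ × ℤ)}

/-- The flip of a corner to the free opposite cell corner is a loop. [folklore] -/
theorem flip_isLoop (h : IsLoop (x₀ :: x₁ :: v :: x₃ :: x₄ :: R))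
    (hv' : x₁ + x₃ - v ∉ x₀ :: x₁ :: v :: x₃ :: x₄ :: R) :
    IsLoop (x₀ :: x₁ :: (x₁ + x₃ - v) :: x₃ :: x₄ :: R) := by
  obtain ⟨h01, ⟨i, hi⟩, ⟨j, hj⟩, h34, hc⟩ := h.window
  have hnd := h.nodup
  simp only [nodup_cons, mem_cons, not_or] at hnd hv'
  refine ⟨by simp, ?_, ?_⟩
  · simp only [nodup_cons, mem_cons, not_or]
    refine ⟨⟨hnd.1.1, Ne.symm hv'.1, hnd.1.2.2⟩, ⟨Ne.symm hv'.2.1, hnd.2.1.2⟩,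
      ⟨hv'.2.2.2.1, hv'.2.2.2.2⟩, hnd.2.2.2.1, hnd.2.2.2.2⟩
  · simp only [cons_append, take_succ_cons, take_zero, isChain_cons_cons]
    refine ⟨h01, ⟨j, ?_⟩, ⟨i, ?_⟩, h34, hc⟩
    · rw [hj]; abel
    · rw [hi]; abel

/-- The flip does not change the turning. [folklore] -/
theorem cycTurn_flip (h : IsLoop (x₀ :: x₁ :: v :: x₃ :: x₄ :: R))
    (hab : cross (x₁ - v) (x₃ - v) ≠ 0) (hv' : x₁ + x₃ - v ∉ x₀ :: x₁ :: v :: x₃ :: x₄ :: R) :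
    cycTurn (x₀ :: x₁ :: (x₁ + x₃ - v) :: x₃ :: x₄ :: R) = cycTurn (x₀ :: x₁ :: v :: x₃ :: x₄ :: R) := by
  obtain ⟨⟨ip, hp⟩, ⟨i, hi⟩, ⟨j, hj⟩, ⟨iq, hq⟩, -⟩ := h.window
  have hnd := h.nodup
  simp only [nodup_cons, mem_cons, not_or] at hnd hv'
  -- `a = x₁ - v = -dir i = dir (i + 2)`, `b = x₃ - v = dir j`
  have ha : x₁ - v = dir (i + 2) := by rw [← neg_dir, hi]; abel
  have hb : x₃ - v = dir j := by rw [hj]; abel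
  have key := flip_identity (i + 2) j ip iq (by rwa [← ha, ← hb]) ?_ ?_ ?_ ?_
  · simp only [cycTurn, cons_append, take_succ_cons, take_zero, turnSum_cons_cons_cons]
    have e1 : x₁ - x₀ = dir ip := by rw [hp]; abel
    have e2 : x₁ + x₃ - v - x₁ = dir j := by rw [hj]; abel
    have e3 : x₃ - (x₁ + x₃ - v) = -dir (i + 2) := by rw [← ha]; abel
    have e4 : v - x₁ = -dir (i + 2) := by rw [← ha]; abel
    have e5 : x₄ - x₃ = dir iq := by rw [hq]; abel
    rw [e1, e2, e3, e4, hb, e5]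
    linear_combination key.symm
  · intro h; apply hnd.1.2.1        -- x₀ = v
    have e : x₀ = x₁ - dir ip := by rw [hp]; abel
    rw [e, h, ← ha]; abel
  · intro h; apply hv'.1             -- x₀ = v'
    have e : x₀ = x₁ - dir ip := by rw [hp]; abel
    rw [e, h, sub_neg_eq_add, ← hb]; abel
  · intro h; apply hnd.2.2.1.2.1     -- v = x₄
    rw [hq, h, ← hb]; abel
  · intro h; apply hv'.2.2.2.2.1     -- v' = x₄
    rw [hq, h, ← ha]; abel

end Flip

/-! ### The forward shortcut -/

section Fwd

variable {x₀ x₁ v x₃ x₄ : ℤ × ℤ} {R : List (ℤ × ℤ)}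

/-- The forward shortcut is a loop. [folklore] -/
theorem fwd_isLoop (h : IsLoop (x₀ :: x₁ :: v :: x₃ :: x₄ :: R)) (hv' : x₁ + x₃ - v = x₄) :
    IsLoop (x₀ :: x₁ :: x₄ :: R) := by
  obtain ⟨h01, ⟨i, hi⟩, ⟨j, hj⟩, h34, hc⟩ := h.window
  refine isLoop_of_window3 (h.nodup.sublist ?_) h01 ⟨j, ?_⟩ hc
  · exact ((((Sublist.refl (x₄ :: R)).cons x₃).cons v).cons_cons x₁).cons_cons x₀
  · rw [← hv', hj]; abel

/-- The forward shortcut does not change the turning. [folklore] -/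
theorem cycTurn_fwd (h : IsLoop (x₀ :: x₁ :: v :: x₃ :: x₄ :: R))
    (hab : cross (x₁ - v) (x₃ - v) ≠ 0) (hv' : x₁ + x₃ - v = x₄) :
    cycTurn (x₀ :: x₁ :: x₄ :: R) = cycTurn (x₀ :: x₁ :: v :: x₃ :: x₄ :: R) := by
  obtain ⟨⟨ip, hp⟩, ⟨i, hi⟩, ⟨j, hj⟩, -, hc⟩ := h.window
  have hnd := h.nodup
  -- the vertex after `x₄`
  obtain ⟨y, M, hyM, hy⟩ : ∃ y M, R ++ [x₀, x₁] = y :: M ∧ y ≠ x₁ ∧ y ≠ x₃ := by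
    simp only [nodup_cons, mem_cons, not_or] at hnd
    cases R with
    | nil => exact ⟨x₀, [x₁], rfl, hnd.1.1, hnd.1.2.2.1⟩
    | cons y R =>
      refine ⟨y, R ++ [x₀, x₁], rfl, ?_, ?_⟩
      · intro e; exact hnd.2.1.2.2.2 (by simp [e])
      · intro e; exact hnd.2.2.2.1.2 (by simp [e])
  obtain ⟨iq, hq⟩ : Adj x₄ y := by
    have hc' : IsChain Adj (x₄ :: (R ++ [x₀, x₁])) := by
      have : R ++ [x₀, x₁] = (R ++ [x₀]) ++ [x₁] := by simp
      rw [this]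
      exact hc.append (isChain_singleton _) (by
        intro a ha b hb
        simp only [Option.mem_def, head?_cons, Option.some.injEq] at hb
        subst hb
        rw [show x₄ :: (R ++ [x₀]) = (x₄ :: R) ++ [x₀] from rfl, getLast?_eq_getLast_of_ne_nil (by simp),
          getLast_append_singleton] at ha
        simp only [Option.mem_def, Option.some.injEq] at ha
        subst ha; exact ⟨ip, hp⟩)
    rw [hyM, isChain_cons_cons] at hc'
    exact hc'.1
  have ha : x₁ - v = dir (i + 2) := by rw [← neg_dir, hi]; abel
  have hb : x₃ - v = dir j := by rw [hj]; abel
  have key := fwd_identity (i + 2) j ip iq (by rwa [← ha, ← hb]) ?_ ?_ ?_ ?_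
  · simp only [cycTurn, cons_append, take_succ_cons, take_zero, hyM, turnSum_cons_cons_cons]
    have e1 : x₁ - x₀ = dir ip := by rw [hp]; abel
    have e2 : x₄ - x₁ = dir j := by rw [← hv', hj]; abel
    have e3 : y - x₄ = dir iq := by rw [hq]; abel
    have e4 : v - x₁ = -dir (i + 2) := by rw [← ha]; abel
    have e5 : x₄ - x₃ = dir (i + 2) := by rw [← hv', ← ha]; abel
    rw [e1, e2, e3, e4, hb, e5]
    linear_combination key.symm
  all_goals simp only [nodup_cons, mem_cons, not_or] at hnd
  · intro h; apply hnd.1.2.1        -- x₀ = v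
    have e : x₀ = x₁ - dir ip := by rw [hp]; abel
    rw [e, h, ← ha]; abel
  · intro h; apply hnd.1.2.2.2.1     -- x₀ = x₄
    have e : x₀ = x₁ - dir ip := by rw [hp]; abel
    rw [e, h, sub_neg_eq_add, ← hb, ← hv']; abel
  · intro h; apply hy.2              -- y = x₃
    rw [hq, h, ← ha, ← hv']; abel
  · intro h; apply hy.1              -- y = x₁
    rw [hq, h, ← hb, ← hv']; abel

end Fwd

/-! ### The backward shortcut -/

section Bwd

variable {z x₀ x₁ v x₃ : ℤ × ℤ} {R : List (ℤ × ℤ)}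

/-- The backward shortcut is a loop. [folklore] -/
theorem bwd_isLoop (h : IsLoop (z :: x₀ :: x₁ :: v :: x₃ :: R)) (hv' : x₁ + x₃ - v = x₀) :
    IsLoop (z :: x₀ :: x₃ :: R) := by
  obtain ⟨hz0, ⟨i, hi⟩, ⟨j, hj⟩, ⟨k, hk⟩, hc⟩ := h.window
  refine isLoop_of_window3 (h.nodup.sublist ?_) hz0 ⟨j, ?_⟩ hc
  · exact ((((Sublist.refl (x₃ :: R)).cons v).cons x₁).cons_cons x₀).cons_cons z
  · rw [← hv', hj]; abel

/-- The backward shortcut does not change the turning. [folklore] -/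
theorem cycTurn_bwd (h : IsLoop (z :: x₀ :: x₁ :: v :: x₃ :: R))
    (hab : cross (x₁ - v) (x₃ - v) ≠ 0) (hv' : x₁ + x₃ - v = x₀) :
    cycTurn (z :: x₀ :: x₃ :: R) = cycTurn (z :: x₀ :: x₁ :: v :: x₃ :: R) := by
  obtain ⟨⟨ip, hp⟩, -, ⟨i, hi⟩, ⟨j, hj⟩, hc⟩ := h.window
  have hnd := h.nodup
  -- the vertex after `x₃`
  obtain ⟨x₄, M, hyM, hy⟩ : ∃ x₄ M, R ++ [z, x₀] = x₄ :: M ∧ x₄ ≠ x₀ ∧ x₄ ≠ v := by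
    simp only [nodup_cons, mem_cons, not_or] at hnd
    cases R with
    | nil => exact ⟨z, [x₀], rfl, hnd.1.1, hnd.1.2.2.1⟩
    | cons y R =>
      refine ⟨y, R ++ [z, x₀], rfl, ?_, ?_⟩
      · intro e; exact hnd.2.1.2.2.2 (by simp [e])
      · intro e; exact hnd.2.2.2.1.2 (by simp [e])
  obtain ⟨iq, hq⟩ : Adj x₃ x₄ := by
    have hc' : IsChain Adj (x₃ :: (R ++ [z, x₀])) := by
      have : R ++ [z, x₀] = (R ++ [z]) ++ [x₀] := by simp
      rw [this]
      exact hc.append (isChain_singleton _) (by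
        intro a ha b hb
        simp only [Option.mem_def, head?_cons, Option.some.injEq] at hb
        subst hb
        rw [show x₃ :: (R ++ [z]) = (x₃ :: R) ++ [z] from rfl, getLast?_eq_getLast_of_ne_nil (by simp),
          getLast_append_singleton] at ha
        simp only [Option.mem_def, Option.some.injEq] at ha
        subst ha; exact ⟨ip, hp⟩)
    rw [hyM, isChain_cons_cons] at hc'
    exact hc'.1
  have ha : x₁ - v = dir (i + 2) := by rw [← neg_dir, hi]; abel
  have hb : x₃ - v = dir j := by rw [hj]; abel
  have key := bwd_identity (i + 2) j ip iq (by rwa [← ha, ← hb]) ?_ ?_ ?_ ?_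
  · simp only [cycTurn, cons_append, take_succ_cons, take_zero, hyM, turnSum_cons_cons_cons]
    have e1 : x₀ - z = dir ip := by rw [hp]; abel
    have e2 : x₁ - x₀ = -dir j := by rw [← hv', ← hb]; abel
    have e3 : v - x₁ = -dir (i + 2) := by rw [← ha]; abel
    have e4 : x₄ - x₃ = dir iq := by rw [hq]; abel
    have e5 : x₃ - x₀ = -dir (i + 2) := by rw [← hv', ← ha]; abel
    rw [e1, e2, e3, hb, e4, e5]
    linear_combination key.symm
  all_goals simp only [nodup_cons, mem_cons, not_or] at hnd
  · intro h; apply hnd.1.2.2.2.1    -- z = x₃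
    have e : z = x₀ - dir ip := by rw [hp]; abel
    rw [e, h, ← ha, ← hv']; abel
  · intro h; apply hnd.1.2.1        -- z = x₁
    have e : z = x₀ - dir ip := by rw [hp]; abel
    rw [e, h, ← hb, ← hv']; abel
  · intro h; apply hy.2              -- x₄ = v
    rw [hq, h, ← hb]; abel
  · intro h; apply hy.1              -- x₄ = x₀
    rw [hq, h, ← ha, ← hv']; abel

end Bwd

end RectLoop

end Literature.Topology.PlaneTopology
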